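import Literature.Probability.Percolation.SeedExploration
import Literature.Probability.Percolation.HutchcroftVolumeCovariance
import Literature.Probability.ODonnellSaksSchrammServedio2005.OSInequality
import HarnessLib

/-!
# The STOPPED cluster exploration as a query strategy: revealment budget `≤ (k−1)·(max degree)` and the
# O'Donnell–Servedio bound for the volume indicator `𝟙[|C(v)| ≥ k]` on a finite graph
# — quant lane, METHOD = influence/revealment bounds for `θ` near `p_c`, seat p4 gen 36, file 5

builds on p205010 (kernel theorem, internal audit signed; external expert review pending).
Status sentence for p205010: "θ(p_c) = 0 on ℤ^d, all d ≥ 2 — kernel-verified (Lean 4/Mathlib, standard axioms); internal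
adversarial audit SIGNED 2026-08-20 04:29Z; external expert review pending."  (Nothing in THIS file uses p205010.)

Seat `prim-quant-p4`, `--supports stmt-CriticalPhenomena-4575`; pure proofs, no definitions (`local notation3` only).
Framework: the tree's query strategies (`Strategy.build/tree/revealment`, `StrategyTree.lean`), the seed exploration of DRT
(`SeedExploration.Active/SeedConn/…`, `SeedExploration.lean`), the finite-graph clusters `cl edge x a` and the volume indicator
`GhostExploration.fvol edge k v = 𝟙[k ≤ |cl x v|]` (`HutchcroftVolumeCovariance.lean`), and the OS inequality (`Strategy.os_sum_cov_le_strategy`).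

THE POINT.  The tree's seed exploration explores the whole cluster (revealment `≍ χ`).  For the VOLUME event `{|C(v)| ≥ k}` one stops
as soon as `k` active vertices are found ("a decision tree that explores the cluster … stopping if and when it first finds `n`
vertices", Hutchcroft 2022 §4 — in the tree as `ClusterExploration` for `bondPercolation`, but not in the `Strategy` framework of
the OS inequality).  Here:
* §1 **a query budget for strategies** (`queried_tree_subset_of_budget`, `sum_queried_tree_le`, `sum_revealment_mul_le`): if every
  query lies in a finite set `Φ σ` that grows along extensions, the queried set along any input lies in `Φ σ*` for some NON-HALTED
  state `σ*`; so a bound `Σ_{e ∈ Φ σ} w_e ≤ B` at non-halted states bounds `Σ_e δ_e w_e ≤ B`.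
* §2 **the stopped seed exploration** `STOP[k]` (seed `{v}`): query an unqueried edge label with an active endpoint while fewer than
  `k` vertices are active; legal; at a halting state consistent with the input its label `𝟙[k ≤ #active]` equals `fvol` (either `k`
  active vertices were found — all in the cluster — or the cluster is exhausted and equals the active set); every query has an
  active endpoint and is made with `< k` active vertices.
* §3 **`VolOS.sum_cov_fvol_le_sqrt`** — THE OS BOUND FOR THE VOLUME: if at every non-halted state
  `Σ_{e : some endpoint active} p_e(1−p_e) ≤ B`, then `Σ_e E_p[fvol·φ_e] ≤ √(m(1−m)·B)`, `m = E_p[fvol] = P(|C(v)| ≥ k)`.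
The lattice instance (`B = 2d(k−1)p(1−p)` on `Λ_N ⊂ ℤ^d`, Russo: `|d/dp P_p(|C| ≥ k)| ≤ √(2d(k−1)P(1−P)/(p(1−p)))` at EVERY `p`) is the sequel
`…QuantVolumeTailDerivOS`.

HONEST STATUS.  Folklore-level tooling, NEW AS TYPED (the OS inequality and the stopped exploration are printed; their combination for
the volume tail is not located in print — presearch in P4-MODULUS §41).  NO rate; (T1)/(T2) and the lane's honest sentence UNCHANGED.

## References
* R. O'Donnell, R. Servedio, *Learning monotone decision trees in polynomial time*, SIAM J. Comput. 37 (2007); R. O'Donnell,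
  *Analysis of Boolean Functions* (2014) §8.6 "OS inequality" [ODonnell2014].
* T. Hutchcroft, J. Stat. Phys. 189 (2022), §4 (the exploration stopped at `n` vertices) [Hutchcroft2022Triangle].
* H. Duminil-Copin, A. Raoufi, V. Tassion, Ann. of Math. 189 (2019) §3 (seed explorations) [DuminilCopinRaoufiTassion2019].
-/

noncomputable section

namespace Summit.CriticalPhenomena.PercolationContinuityZ3.Theorems

open Finset Function Literature.Probability.ODonnellSaksSchrammServedio2005
open Literature.Probability.ODonnellSaksSchrammServedio2005.Strategy
open Literature.Probability.Percolation Literature.Probability.Percolation.SeedExploration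
open scoped Classical

namespace VolOS

/-! ### §1. A query budget for strategies -/

section Budget

variable {ι : Type*} [DecidableEq ι]

/-- The tree compiled at a halting state is a leaf: it queries nothing. [cite: Hutchcroft2020, §2.3 (decision trees as query strategies)] -/
theorem queried_build_of_halt (S : (ι → Option Bool) → Option ι) (L : (ι → Option Bool) → ℝ) (k : ℕ)
    {σ : ι → Option Bool} (h : S σ = none) (x : ι → Bool) : (build S L k σ).queried x = ∅ := by
  cases k with
  | zero => simp [build, DecTree.queried]
  | succ k => simp [build, h, DecTree.queried]

/-- **Budget lemma (tree form).**  Let `S` be legal and `Φ σ` a finite set of coordinates with (i) every query lies in it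
(`S σ = some j ⟹ j ∈ Φ σ`) and (ii) it grows along extensions of the partial assignment.  Then from every NON-halted state `σ`,
the coordinates queried by `build S L k σ` along an input all lie in `Φ σ*` for some extension `σ*` of `σ` that is still non-halted.
[cite: OdonnellEtAl2005, §3.2 proof of Thm 3.1 (no variable queried twice)] -/
theorem queried_build_subset_of_budget {S : (ι → Option Bool) → Option ι} (hS : Legal S) (L : (ι → Option Bool) → ℝ)
    (Φ : (ι → Option Bool) → Finset ι) (hq : ∀ σ j, S σ = some j → j ∈ Φ σ)
    (hmono : ∀ σ σ' : ι → Option Bool, (∀ i b, σ i = some b → σ' i = some b) → Φ σ ⊆ Φ σ') (x : ι → Bool) :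
    ∀ (k : ℕ) (σ : ι → Option Bool), S σ ≠ none →
      ∃ σ' : ι → Option Bool, (∀ i b, σ i = some b → σ' i = some b) ∧ S σ' ≠ none ∧ (build S L k σ).queried x ⊆ Φ σ' := by
  intro k
  induction k with
  | zero => intro σ hσ; exact ⟨σ, fun _ _ h => h, hσ, by simp [build, DecTree.queried]⟩
  | succ k ih =>
    intro σ hσ
    obtain ⟨i, hi⟩ := Option.ne_none_iff_exists'.1 hσ
    set σ₁ : ι → Option Bool := update σ i (some (x i)) with hσ₁
    have hext : ∀ j b, σ j = some b → σ₁ j = some b := by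
      intro j b hj
      by_cases hji : j = i
      · subst hji; rw [hS σ j hi] at hj; cases hj
      · rw [hσ₁, update_of_ne hji]; exact hj
    -- the queried set: `i`, then the subtree at `σ₁`
    have hQ : (build S L (k + 1) σ).queried x = insert i ((build S L k σ₁).queried x) := by
      simp only [build, hi, DecTree.queried]
      rcases Bool.eq_false_or_eq_true (x i) with hx | hx
      · rw [if_pos hx, hσ₁, hx]
      · rw [if_neg (by simp [hx]), hσ₁, hx]
    by_cases h1 : S σ₁ = none
    · refine ⟨σ, fun _ _ h => h, hσ, ?_⟩
      rw [hQ, queried_build_of_halt S L k h1 x, Finset.insert_empty, Finset.singleton_subset_iff]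
      exact hq σ i hi
    · obtain ⟨σ', hext', hne', hsub'⟩ := ih σ₁ h1
      refine ⟨σ', fun j b hj => hext' j b (hext j b hj), hne', ?_⟩
      rw [hQ]
      exact Finset.insert_subset (hmono σ σ' (fun j b hj => hext' j b (hext j b hj)) (hq σ i hi)) hsub'

variable [Fintype ι]

/-- **Budget lemma (weighted count).**  Under the hypotheses of `queried_build_subset_of_budget`, if `w ≥ 0` and
`Σ_{j ∈ Φ σ} w_j ≤ B` at every non-halted state (`B ≥ 0`), then along every input `Σ_{j queried} w_j ≤ B`.
[cite: OdonnellEtAl2005, §1 (cost of a decision tree)] -/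
theorem sum_queried_tree_le {S : (ι → Option Bool) → Option ι} (hS : Legal S) (L : (ι → Option Bool) → ℝ)
    (Φ : (ι → Option Bool) → Finset ι) (hq : ∀ σ j, S σ = some j → j ∈ Φ σ)
    (hmono : ∀ σ σ' : ι → Option Bool, (∀ i b, σ i = some b → σ' i = some b) → Φ σ ⊆ Φ σ')
    {w : ι → ℝ} (hw : ∀ j, 0 ≤ w j) {B : ℝ} (hB0 : 0 ≤ B) (hB : ∀ σ, S σ ≠ none → ∑ j ∈ Φ σ, w j ≤ B) (x : ι → Bool) :
    ∑ j ∈ (tree S L).queried x, w j ≤ B := by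
  unfold tree
  by_cases h0 : S (fun _ => none) = none
  · rw [queried_build_of_halt S L _ h0 x, Finset.sum_empty]; exact hB0
  · obtain ⟨σ', -, hne, hsub⟩ := queried_build_subset_of_budget hS L Φ hq hmono x _ _ h0
    exact (Finset.sum_le_sum_of_subset_of_nonneg hsub fun j _ _ => hw j).trans (hB σ' hne)

/-- **Budget lemma (revealment form)**: `Σ_j δ_j·w_j ≤ B`. [cite: OdonnellEtAl2005, §1 (Δ(T) = expected number of queries)] -/
theorem sum_revealment_mul_le {p : ι → ℝ} (h0 : ∀ i, 0 ≤ p i) (h1 : ∀ i, p i ≤ 1)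
    {S : (ι → Option Bool) → Option ι} (hS : Legal S) (L : (ι → Option Bool) → ℝ)
    (Φ : (ι → Option Bool) → Finset ι) (hq : ∀ σ j, S σ = some j → j ∈ Φ σ)
    (hmono : ∀ σ σ' : ι → Option Bool, (∀ i b, σ i = some b → σ' i = some b) → Φ σ ⊆ Φ σ')
    {w : ι → ℝ} (hw : ∀ j, 0 ≤ w j) {B : ℝ} (hB0 : 0 ≤ B) (hB : ∀ σ, S σ ≠ none → ∑ j ∈ Φ σ, w j ≤ B) :
    ∑ j, revealment p S L j * w j ≤ B := by
  unfold revealment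
  have e1 : ∀ j, (∑ x, wt p x * (if j ∈ (tree S L).queried x then (1 : ℝ) else 0)) * w j =
      ∑ x, wt p x * (if j ∈ (tree S L).queried x then w j else 0) := fun j => by
    rw [Finset.sum_mul]
    refine Finset.sum_congr rfl fun x _ => ?_
    split_ifs <;> ring
  have e2 : ∀ x, ∑ j, wt p x * (if j ∈ (tree S L).queried x then w j else 0) = wt p x * ∑ j ∈ (tree S L).queried x, w j :=
    fun x => by rw [← Finset.mul_sum, Finset.sum_ite_mem, Finset.univ_inter]
  calc ∑ j, (∑ x, wt p x * (if j ∈ (tree S L).queried x then (1 : ℝ) else 0)) * w j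
      = ∑ x, wt p x * ∑ j ∈ (tree S L).queried x, w j := by
        rw [Finset.sum_congr rfl fun j _ => e1 j, Finset.sum_comm]
        exact Finset.sum_congr rfl fun x _ => e2 x
    _ ≤ ∑ x, wt p x * B := Finset.sum_le_sum fun x _ =>
        mul_le_mul_of_nonneg_left (sum_queried_tree_le hS L Φ hq hmono hw hB0 hB x) (wt_nonneg h0 h1 x)
    _ = B := by rw [← Finset.sum_mul, sum_wt, one_mul]

end Budget

/-! ### §2. The stopped seed exploration -/

section Stopped

variable {W E : Type*} [Fintype W] [Fintype E] [DecidableEq E] (edge : W → W → Option E)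

/-- `ACT[σ]`: the finite set of active vertices (joined to the seed `v` by queried-open edges). -/
local notation3 "ACT[" v ", " σ "]" => (Finset.univ.filter fun a => Active edge ({v} : Set _) σ a)

/-- `STOP[v, k]`: the seed exploration from `{v}` STOPPED at `k` active vertices. -/
local notation3 "STOP[" v ", " k "]" => fun σ : E → Option Bool =>
  if h : (∃ e, σ e = none ∧ ∃ a b, edge a b = some e ∧ Active edge ({v} : Set _) σ a) ∧ (ACT[v, σ]).card < k
    then some (Classical.choose h.1) else none

/-- `ADM[v, σ]`: the admissible labels at `σ` — those with an active endpoint. -/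
local notation3 "ADM[" v ", " σ "]" => (Finset.univ.filter fun e => ∃ a b, edge a b = some e ∧ Active edge ({v} : Set _) σ a)

/-- `INC[a]`: the labels carried by the vertex `a`. -/
local notation3 "INC[" a "]" => (Finset.univ.filter fun e => ∃ b, edge a b = some e)

/-- `LAB[v, k]`: the leaf labels `𝟙[k ≤ #active]`. -/
local notation3 "LAB[" v ", " k "]" => fun σ : E → Option Bool => if k ≤ (ACT[v, σ]).card then (1 : ℝ) else 0

/-- The stopped exploration is legal. [cite: DuminilCopinRaoufiTassion2019, §3 proof of Lemma 3.2 (T is a decision tree)] -/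
theorem stop_legal (v : W) (k : ℕ) : Legal (STOP[v, k]) := by
  intro σ i hi
  simp only at hi
  split_ifs at hi with h
  cases hi; exact (Classical.choose_spec h.1).1

/-- A query of the stopped exploration has an active endpoint and is made with fewer than `k` active vertices.
[cite: Hutchcroft2022Triangle, §4 (stopping when n vertices are found)] -/
theorem stop_spec {v : W} {k : ℕ} {σ : E → Option Bool} {e : E} (h : (STOP[v, k]) σ = some e) :
    (∃ a b, edge a b = some e ∧ Active edge ({v} : Set _) σ a) ∧ (ACT[v, σ]).card < k := by
  simp only at h
  split_ifs at h with hc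
  simp only [Option.some.injEq] at h
  obtain ⟨_, a, b, hab, hact⟩ := Classical.choose_spec hc.1
  exact ⟨⟨a, b, h ▸ hab, hact⟩, hc.2⟩

variable {edge}

omit [Fintype W] [Fintype E] [DecidableEq E] in
/-- Activity grows along extensions of the partial assignment. [cite: DuminilCopinRaoufiTassion2019, §3 proof of Lemma 3.2 (V_t increasing)] -/
theorem active_mono {Z : Set W} {σ σ' : E → Option Bool} (hext : ∀ i b, σ i = some b → σ' i = some b) {a : W}
    (ha : Active edge Z σ a) : Active edge Z σ' a := by
  obtain ⟨u, hu, hr⟩ := ha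
  refine ⟨u, hu, ?_⟩
  unfold SReach at hr ⊢
  refine Relation.ReflTransGen.mono (fun c d hcd => ?_) _ _ hr
  obtain ⟨hne, e, he, hσ⟩ := hcd
  exact ⟨hne, e, he, hext e true hσ⟩

variable (edge)

/-- **Halting correctness**: at a halting state of `STOP[v,k]` consistent with the input, `𝟙[k ≤ #active] = fvol_k(v)` — either `k`
active vertices were found (all in the cluster of `v`), or no edge is pending and the active set IS the cluster.
[cite: Hutchcroft2022Triangle, §4 (the tree determines 1(|K| ≥ n))] -/
theorem stop_label_eq_of_halt (v : W) (k : ℕ) (σ : E → Option Bool) (x : E → Bool)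
    (hc : Consistent σ x) (hh : (STOP[v, k]) σ = none) : (LAB[v, k]) σ = GhostExploration.fvol edge k v x := by
  have hsub : ACT[v, σ] ⊆ GhostExploration.cl edge x v := by
    intro a ha
    rw [Finset.mem_filter] at ha
    obtain ⟨u, hu, hr⟩ := ha.2
    rw [Set.mem_singleton_iff] at hu; subst hu
    simp only [GhostExploration.cl, Finset.mem_filter, Finset.mem_univ, true_and]
    exact yReach_of_sReach hc hr
  simp only at hh
  split_ifs at hh with hcase
  rw [not_and_or, not_lt] at hcase
  unfold GhostExploration.fvol
  simp only
  rcases hcase with hnp | hk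
  · -- no pending edge: the active set is the cluster
    have h' : ∀ e, σ e = none → ∀ a b, edge a b = some e → ¬Active edge ({v} : Set _) σ a := by
      intro e he a b hab hact; exact hnp ⟨e, he, a, b, hab, hact⟩
    have heq : ACT[v, σ] = GhostExploration.cl edge x v := by
      refine Finset.Subset.antisymm hsub fun a ha => ?_
      simp only [GhostExploration.cl, Finset.mem_filter, Finset.mem_univ, true_and] at ha
      rw [Finset.mem_filter]
      exact ⟨Finset.mem_univ _, v, rfl, sReach_of_yReach_of_noPending hc h' rfl ha⟩
    rw [heq]
  · -- `k` active vertices found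
    rw [if_pos hk, if_pos (hk.trans (Finset.card_le_card hsub))]

/-- **THE O'DONNELL–SERVEDIO BOUND FOR THE VOLUME INDICATOR** on a finite graph: if at every
non-halted state of `STOP[v,k]` the bias-weights of the labels with an active endpoint satisfy `Σ p_e(1−p_e) ≤ B` (`B ≥ 0`), then
`Σ_e E_p[fvol·φ_e] ≤ √(m(1−m)·B)` with `m = E_p[fvol_k(v)]`. [cite: ODonnell2014, §8.6 OS Inequality] [cite: Hutchcroft2022Triangle, §4] -/
theorem sum_cov_fvol_le_sqrt (p : E → ℝ) (h0 : ∀ i, 0 ≤ p i) (h1 : ∀ i, p i ≤ 1)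
    (v : W) (k : ℕ) {B : ℝ} (hB0 : 0 ≤ B)
    (hB : ∀ σ : E → Option Bool, (STOP[v, k]) σ ≠ none →
      ∑ e ∈ ADM[v, σ], p e * (1 - p e) ≤ B) :
    ∑ e, ∑ x, wt p x * (GhostExploration.fvol edge k v x * ctr p e x) ≤
      Real.sqrt ((∑ x, wt p x * GhostExploration.fvol edge k v x) * (1 - ∑ x, wt p x * GhostExploration.fvol edge k v x) * B) := by
  have os := os_sum_cov_le_strategy p h0 h1 (stop_legal edge v k) (LAB[v, k]) (g := GhostExploration.fvol edge k v)
    (fun σ x hc hh => stop_label_eq_of_halt edge v k σ x hc hh) Finset.univ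
  refine os.trans (Real.sqrt_le_sqrt ?_)
  -- variance of the indicator `= m(1−m)`
  set m : ℝ := ∑ x, wt p x * GhostExploration.fvol edge k v x with hm
  have hf01 : ∀ x : E → Bool, GhostExploration.fvol edge k v x ^ 2 = GhostExploration.fvol edge k v x := fun x => by unfold GhostExploration.fvol; split_ifs <;> norm_num
  have hvar : ∑ x, wt p x * (GhostExploration.fvol edge k v x - m) ^ 2 = m * (1 - m) := by
    have hexp : ∀ x : E → Bool, wt p x * (GhostExploration.fvol edge k v x - m) ^ 2 =
        wt p x * GhostExploration.fvol edge k v x - 2 * m * (wt p x * GhostExploration.fvol edge k v x) + m ^ 2 * wt p x := fun x => by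
      rw [sub_sq, hf01 x]; ring
    simp only [hexp, Finset.sum_add_distrib, Finset.sum_sub_distrib, ← Finset.mul_sum, sum_wt, ← hm]
    ring
  rw [hvar]
  have hm0 : 0 ≤ m := Finset.sum_nonneg fun x _ => mul_nonneg (wt_nonneg h0 h1 x) (GhostExploration.fvol_nonneg k v x)
  have hm1 : m ≤ 1 := by
    calc m ≤ ∑ x, wt p x * 1 := Finset.sum_le_sum fun x _ => mul_le_mul_of_nonneg_left
          (by unfold GhostExploration.fvol; split_ifs <;> norm_num) (wt_nonneg h0 h1 x)
      _ = 1 := by rw [← Finset.sum_mul, sum_wt, one_mul]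
  refine mul_le_mul_of_nonneg_left ?_ (mul_nonneg hm0 (by linarith))
  -- the revealment budget
  refine sum_revealment_mul_le h0 h1 (stop_legal edge v k) (LAB[v, k]) (fun σ => ADM[v, σ])
    (fun σ j hj => ?_) (fun σ σ' hext => ?_) (fun j => mul_nonneg (h0 j) (sub_nonneg.2 (h1 j))) hB0 hB
  · rw [Finset.mem_filter]; exact ⟨Finset.mem_univ _, (stop_spec edge hj).1⟩
  · intro e he
    rw [Finset.mem_filter] at he ⊢
    obtain ⟨-, a, b, hab, hact⟩ := he
    exact ⟨Finset.mem_univ _, a, b, hab, active_mono hext hact⟩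

/-- **The budget at non-halted states**: fewer than `k` active vertices, every admissible label has an active endpoint, so with at most
`D` weighted labels per vertex, `Σ_{e admissible} p_e(1−p_e) ≤ (k−1)·D`. [cite: Hutchcroft2022Triangle, §4 (at most Δ·n queries)] -/
theorem budget_of_degree (p : E → ℝ) (h0 : ∀ i, 0 ≤ p i) (h1 : ∀ i, p i ≤ 1) (v : W) (k : ℕ) {D : ℝ}
    (hdeg : ∀ a : W, ∑ e ∈ INC[a], p e * (1 - p e) ≤ D)
    (σ : E → Option Bool) (hσ : (STOP[v, k]) σ ≠ none) :
    ∑ e ∈ ADM[v, σ], p e * (1 - p e) ≤ ((k : ℝ) - 1) * D := by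
  obtain ⟨e₀, he₀⟩ := Option.ne_none_iff_exists'.1 hσ
  have hspec := stop_spec edge he₀
  have hcard : (ACT[v, σ]).card < k := hspec.2
  have hD0 : 0 ≤ D := le_trans (Finset.sum_nonneg fun e _ => mul_nonneg (h0 e) (sub_nonneg.2 (h1 e))) (hdeg v)
  -- the admissible labels lie in the union over active vertices of the labels at that vertex
  have hsub : ADM[v, σ] ⊆ (ACT[v, σ]).biUnion fun a => INC[a] := by
    intro e he
    rw [Finset.mem_filter] at he
    obtain ⟨-, a, b, hab, hact⟩ := he
    rw [Finset.mem_biUnion]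
    exact ⟨a, by rw [Finset.mem_filter]; exact ⟨Finset.mem_univ _, hact⟩, by rw [Finset.mem_filter]; exact ⟨Finset.mem_univ _, b, hab⟩⟩
  -- a sum over a `biUnion` is at most the sum of the sums (nonnegative summands)
  have hbU : ∀ s : Finset W, ∑ e ∈ s.biUnion (fun a => INC[a]), p e * (1 - p e) ≤ ∑ a ∈ s, ∑ e ∈ INC[a], p e * (1 - p e) := by
    intro s
    induction s using Finset.induction_on with
    | empty => simp
    | insert i s hi ih =>
      rw [Finset.biUnion_insert, Finset.sum_insert hi]
      have h := Finset.sum_union_inter (s₁ := INC[i]) (s₂ := s.biUnion (fun a => INC[a])) (f := fun e => p e * (1 - p e))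
      have hnn : 0 ≤ ∑ e ∈ INC[i] ∩ s.biUnion (fun a => INC[a]), p e * (1 - p e) :=
        Finset.sum_nonneg fun e _ => mul_nonneg (h0 e) (sub_nonneg.2 (h1 e))
      linarith
  have hk1 : ((ACT[v, σ]).card : ℝ) ≤ (k : ℝ) - 1 := by
    have : (ACT[v, σ]).card + 1 ≤ k := hcard
    have h' : ((ACT[v, σ]).card : ℝ) + 1 ≤ (k : ℝ) := by exact_mod_cast this
    linarith
  calc ∑ e ∈ ADM[v, σ], p e * (1 - p e)
      ≤ ∑ e ∈ (ACT[v, σ]).biUnion (fun a => INC[a]), p e * (1 - p e) :=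
        Finset.sum_le_sum_of_subset_of_nonneg hsub fun e _ _ => mul_nonneg (h0 e) (sub_nonneg.2 (h1 e))
    _ ≤ ∑ a ∈ ACT[v, σ], ∑ e ∈ INC[a], p e * (1 - p e) := hbU _
    _ ≤ ∑ a ∈ ACT[v, σ], D := Finset.sum_le_sum fun a _ => hdeg a
    _ = ((ACT[v, σ]).card : ℝ) * D := by rw [Finset.sum_const, nsmul_eq_mul]
    _ ≤ ((k : ℝ) - 1) * D := mul_le_mul_of_nonneg_right hk1 hD0

end Stopped

end VolOS

end Summit.CriticalPhenomena.PercolationContinuityZ3.Theorems
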